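import Summits.HodgeConjecture.HodgeConjecture.Theorems.F0P3cStCharTSOffStratumSum     -- ★ p849833 (this seat) `isLocalDeltaTransfer_of_levi'`
import Summits.HodgeConjecture.HodgeConjecture.Theorems.F0P3cStCharTSHleviSummands      -- ★ p849774 (this seat) KIT-A `hOH_of_summands`, `isLocSmooth_finset_sum_smul`; brings ★ p849750 `hlevi_of_closed_forms`
import Summits.HodgeConjecture.HodgeConjecture.Theorems.F0P3cStCharTSHleviCosets        -- ★ p849792 (this seat) KIT-B `hc_of_cosetSum`
import HarnessLib

/-!
# F0 · P3c · line LH6 «StCharTS» — road (D) «DEEP-FL», (D-c) «TRANSFER OF CHECKLIST»: the Δ‴-transfer clause of XIG-St for the refined test function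
# `f^H₀ = Σ_{j∈s} c_j • g_j` against the shell indicator `f`, ASSEMBLED from the kernel chain — every remaining input is one named brick of ROAD-D v7 BY SHAPE

Cell `pub/hodgecm-mathlib`, crux H413 = `stmt-HodgeConjecture-24833` (lane `--supports … --as helper`), route HCCMUnconditional; seat LH6-p04 (g3) = road (D) owner of record
(spec ROAD-D v7 `F0/P3b/LH6-p04/g3/ROAD-D.status.v7.txt` 7d68ee6667d2d4d5, § KERNEL CHAIN / TRANSFER CLAUSE).  THEOREMS ONLY, sorry-free, ★-only imports; no definition ∕ instance ∕
notation ∕ named fact.  HONEST LABEL: HC_CM is proved only modulo the 7 printed citations (2 remaining: hLiu418 = stmt-HodgeConjecture-24832, h413 = stmt-HodgeConjecture-24833) until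
rung 0 closes; count-neutral — this is the TRANSFER third of the (D-c) HEAD «XIG-ASSEMBLY» with its analytic inputs as hypotheses; (S-X) stays sorried until the head lands.

THE MATHEMATICS ([Rogawski1990, §4.3 (4.3.1) p. 43; §4.9 Lemma 4.9.2, (4.9.4) p. 56; §12.7 L. 12.7.3 (proof) p. 195]).  The chain, all ★:
`IsLocalDeltaTransfer Δ‴ (f^H₀, f)` ⇐ ★ `isLocalDeltaTransfer_of_levi'` [G-shell data, `tsupport f^H₀` ON, `tsupport f ⊆` shell, `hlevi`] ⇐ ★ `hlevi_of_closed_forms` [`hOG`, `hOH`, `hc`]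
⇐ ★ `hOH_of_summands` [per-summand `hOH_j`] + ★ `hc_of_cosetSum` [coset checklist].  This file performs the composition once and for all, so that the (D-c) head only has to
discharge NAMED hypotheses: (G) the shell data of `f = 𝟙_{K_n (z aᵐ) K_n}` («G-SHELL-DATA★»); (ON) `tsupport f^H₀` ON («SHELL-ON★»); (OG) the `G`-side closed form with explicit two-coset
step function `κ_G·(𝟙_{B₁} + κ𝟙_{B₂})` («OCAN-SHELL★»); (OH) the per-summand `H`-side closed forms with step functions `κ_{H,j}·(𝟙_{C_j} + κ′_j 𝟙_{C′_j})` («HOH-SHELL-H★»); (CL) the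
oriented coset checklist `hC horient hflip hcov hsub hτ hval` («COSET-COVER★», «HORIENT★», «FLIP-OFF★», «HTAU-ON-COSET★», the choice of `c_j`).

* **`isLocalDeltaTransfer_doubleCosetSum_of_checklist`** — the composition.

## References
* [Rogawski1990] J. D. Rogawski, *Automorphic Representations of Unitary Groups in Three Variables*, Ann. of Math. Stud. 123 (1990): §4.3 (4.3.1) p. 43; §4.9 Lemma
  4.9.2, (4.9.4) p. 56; §12.7 Lemma 12.7.3 (proof) p. 195.
* [vanDijk1972] G. van Dijk, *Computation of certain induced characters of p-adic groups*, Math. Ann. 199 (1972), Thm. p. 237.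
-/

set_option autoImplicit false
-- the mandated namespace has the single-problem summit's repeated segment (`HodgeConjecture.HodgeConjecture`)
set_option linter.dupNamespace false

noncomputable section

open MeasureTheory Matrix NumberField IsDedekindDomain
open scoped NNReal MatrixGroups
open Literature.NumberTheory.Rogawski1990 Literature.NumberTheory.Automorphic Literature.NumberTheory.Automorphic.UnitaryGroup
open Literature.NumberTheory.GaloisRepresentations

namespace Summit.HodgeConjecture.HodgeConjecture.Cruxes.H413.F0P3cStCharTSTransferChecklist

variable (L : Type) [Field L] [NumberField L] [IsCMField L] (v : HeightOneSpectrum (𝓞 ↥(maximalRealSubfield L)))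
  (w : PlacesOver L v) (hw : IsCMField.complexConj L • w.1 = w.1)

open scoped Classical in
set_option maxHeartbeats 3200000 in  -- statement-level `whnf` on the CM carriers and the modulus tokens
set_option synthInstance.maxHeartbeats 400000 in
/-- **(D-c) «TRANSFER OF CHECKLIST».**  Δ‴ = `finExplicitCollection L (qsForm L) μ hl hr v`; `m_H` admissible on the `G`-regular classes, any `m_G`; the `G`-shell data of
`f` (`K_n` of level `r < 1` at `w`, `E₃ z = β·1`, `|β| = 1`, `E₃ a = diag(α, 1, (σ_w α)⁻¹)`, `0 < |α| < 1`, `m ≥ 1`, `tsupport f ⊆ K_n (z aᵐ) K_n`); a finite family `g_j ∈ C_c^∞(H_v)`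
with coefficients `c_j` whose sum `f^H₀ = Σ_{j∈s} c_j • g_j` is supported ON the stratum; the `G`-side closed form `hOG` with two-coset step function `κ_G·(𝟙_{B₁} + κ𝟙_{B₂})` on `T₃`;
the per-summand `H`-side closed forms `hOHj` with step functions `κ_{H,j}·(𝟙_{C_j} + κ′_j 𝟙_{C′_j})` on `T₂ × U(Φ₁)_v`; and the oriented coset checklist of ★ `hc_of_cosetSum`
(`hC horient hflip hcov hsub hτ hval`).  THEN `IsLocalDeltaTransfer L Φ₃ v Δ‴ m_H m_G f^H₀ f`.
[cite: Rogawski1990, §4.3 (4.3.1) p. 43; §4.9 Lemma 4.9.2, (4.9.4) p. 56; §12.7 Lemma 12.7.3 (proof) p. 195] [cite: vanDijk1972, Thm. p. 237] -/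
theorem isLocalDeltaTransfer_doubleCosetSum_of_checklist
    [∀ γ : (cmDatum L 3 (qsForm L)).Local v, MeasurableSpace ((cmDatum L 3 (qsForm L)).Local v ⧸ Subgroup.centralizer ({γ} : Set ((cmDatum L 3 (qsForm L)).Local v)))]
    [∀ aH : ((cmDatum L 2 (Matrix.of fun i j : Fin 2 => if i.val + j.val + 1 = 2 then (1 : L) else 0)).Local v × (cmDatum L 1 (Matrix.of fun i j : Fin 1 => if i.val + j.val + 1 = 1 then (1 : L) else 0)).Local v),
      MeasurableSpace (((cmDatum L 2 (Matrix.of fun i j : Fin 2 => if i.val + j.val + 1 = 2 then (1 : L) else 0)).Local v × (cmDatum L 1 (Matrix.of fun i j : Fin 1 => if i.val + j.val + 1 = 1 then (1 : L) else 0)).Local v) ⧸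
        Subgroup.centralizer ({aH} : Set ((cmDatum L 2 (Matrix.of fun i j : Fin 2 => if i.val + j.val + 1 = 2 then (1 : L) else 0)).Local v × (cmDatum L 1 (Matrix.of fun i j : Fin 1 => if i.val + j.val + 1 = 1 then (1 : L) else 0)).Local v)))]
    [∀ aH : ((cmDatum L 2 (Matrix.of fun i j : Fin 2 => if i.val + j.val + 1 = 2 then (1 : L) else 0)).Local v × (cmDatum L 1 (Matrix.of fun i j : Fin 1 => if i.val + j.val + 1 = 1 then (1 : L) else 0)).Local v),
      BorelSpace (((cmDatum L 2 (Matrix.of fun i j : Fin 2 => if i.val + j.val + 1 = 2 then (1 : L) else 0)).Local v × (cmDatum L 1 (Matrix.of fun i j : Fin 1 => if i.val + j.val + 1 = 1 then (1 : L) else 0)).Local v) ⧸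
        Subgroup.centralizer ({aH} : Set ((cmDatum L 2 (Matrix.of fun i j : Fin 2 => if i.val + j.val + 1 = 2 then (1 : L) else 0)).Local v × (cmDatum L 1 (Matrix.of fun i j : Fin 1 => if i.val + j.val + 1 = 1 then (1 : L) else 0)).Local v)))]
    (μ : HeckeCharacter L)
    (hl : ∀ (v : HeightOneSpectrum (𝓞 ↥(maximalRealSubfield L)))
      (a : (UnitaryGroup.cmDatum L 2 (Matrix.of fun i j : Fin 2 => if i.val + j.val + 1 = 2 then (1 : L) else 0)).Local v ×
      (UnitaryGroup.cmDatum L 1 (Matrix.of fun i j : Fin 1 => if i.val + j.val + 1 = 1 then (1 : L) else 0)).Local v)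
      (b : (UnitaryGroup.cmDatum L 3 (qsForm L)).Local v)
      (x : (UnitaryGroup.cmDatum L 2 (Matrix.of fun i j : Fin 2 => if i.val + j.val + 1 = 2 then (1 : L) else 0)).Local v ×
      (UnitaryGroup.cmDatum L 1 (Matrix.of fun i j : Fin 1 => if i.val + j.val + 1 = 1 then (1 : L) else 0)).Local v),
      finExplicitDelta L v (qsForm L) (x * a * x⁻¹) μ b = finExplicitDelta L v (qsForm L) a μ b)
    (hr : ∀ (v : HeightOneSpectrum (𝓞 ↥(maximalRealSubfield L)))
      (a : (UnitaryGroup.cmDatum L 2 (Matrix.of fun i j : Fin 2 => if i.val + j.val + 1 = 2 then (1 : L) else 0)).Local v ×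
      (UnitaryGroup.cmDatum L 1 (Matrix.of fun i j : Fin 1 => if i.val + j.val + 1 = 1 then (1 : L) else 0)).Local v)
      (b y : (UnitaryGroup.cmDatum L 3 (qsForm L)).Local v),
      finExplicitDelta L v (qsForm L) a μ (y * b * y⁻¹) = finExplicitDelta L v (qsForm L) a μ b)
    {mH : OrbitalMeasureFamily ((cmDatum L 2 (Matrix.of fun i j : Fin 2 => if i.val + j.val + 1 = 2 then (1 : L) else 0)).Local v × (cmDatum L 1 (Matrix.of fun i j : Fin 1 => if i.val + j.val + 1 = 1 then (1 : L) else 0)).Local v)}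
    (hmH : mH.IsAdmissibleOn (IsLocalGRegular L v))
    (mG : OrbitalMeasureFamily ((cmDatum L 3 (qsForm L)).Local v))
    -- (G) the shell data of `f`
    (Kn : Subgroup ((cmDatum L 3 (qsForm L)).Local v)) {r : WithZero (Multiplicative ℤ)} (hKr : r < 1)
    (hK : ∀ k ∈ Kn, ∀ i j, Valued.v ((((localNonsplitEquiv (IsCMField.complexConj L) (qsForm L) (IsCMField.complexConj_ne_one L) w hw k :
        ↥(unitaryGroupOfForm (galAdicCompletionMap (L := L) (IsCMField.complexConj L) hw) (placeForm (qsForm L) w.1))) :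
        GL (Fin 3) (w.1.adicCompletion L)) : Matrix (Fin 3) (Fin 3) (w.1.adicCompletion L)) i j - (1 : Matrix (Fin 3) (Fin 3) (w.1.adicCompletion L)) i j) ≤ r)
    {z a : (cmDatum L 3 (qsForm L)).Local v} {β α : w.1.adicCompletion L}
    (hz : (((localNonsplitEquiv (IsCMField.complexConj L) (qsForm L) (IsCMField.complexConj_ne_one L) w hw z :
        ↥(unitaryGroupOfForm (galAdicCompletionMap (L := L) (IsCMField.complexConj L) hw) (placeForm (qsForm L) w.1))) :
        GL (Fin 3) (w.1.adicCompletion L)) : Matrix (Fin 3) (Fin 3) (w.1.adicCompletion L)) = β • (1 : Matrix (Fin 3) (Fin 3) (w.1.adicCompletion L)))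
    (hβ : Valued.v β = 1)
    (ha : (((localNonsplitEquiv (IsCMField.complexConj L) (qsForm L) (IsCMField.complexConj_ne_one L) w hw a :
        ↥(unitaryGroupOfForm (galAdicCompletionMap (L := L) (IsCMField.complexConj L) hw) (placeForm (qsForm L) w.1))) :
        GL (Fin 3) (w.1.adicCompletion L)) : Matrix (Fin 3) (Fin 3) (w.1.adicCompletion L)) =
        Matrix.diagonal ![α, 1, ((galAdicCompletionMap (L := L) (IsCMField.complexConj L) hw) α)⁻¹])
    (hα0 : α ≠ 0) (hα1 : Valued.v α < 1) {m : ℕ} (hm : 1 ≤ m)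
    (f : (cmDatum L 3 (qsForm L)).Local v → ℂ)
    (hf : tsupport f ⊆ DoubleCoset.doubleCoset (z * a ^ m) (Kn : Set ((cmDatum L 3 (qsForm L)).Local v)) Kn)
    -- the refined test function `f^H₀ = Σ_j c_j • g_j`, supported ON the stratum
    {ι : Type*} (s : Finset ι) (cj : ι → ℂ) (g : ι → ((cmDatum L 2 (Matrix.of fun i j : Fin 2 => if i.val + j.val + 1 = 2 then (1 : L) else 0)).Local v × (cmDatum L 1 (Matrix.of fun i j : Fin 1 => if i.val + j.val + 1 = 1 then (1 : L) else 0)).Local v) → ℂ) (hg : ∀ j ∈ s, IsLocSmooth (g j))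
    (hfHon : ∀ x ∈ tsupport (∑ j ∈ s, cj j • g j),
      Valued.v ((Pi.evalRingHom (fun w' : PlacesOver L v => w'.1.adicCompletion L) w) ((x.1.val : GL (Fin 2) (LocalRing L v)) : Matrix (Fin 2) (Fin 2) (LocalRing L v)).det) <
        Valued.v ((Pi.evalRingHom (fun w' : PlacesOver L v => w'.1.adicCompletion L) w) ((x.1.val : GL (Fin 2) (LocalRing L v)) : Matrix (Fin 2) (Fin 2) (LocalRing L v)).trace) ^ 2)
    -- (OG) the `G`-side closed form with its two-coset step function
    (B₁ B₂ : Set ↥(cmBorelTriple L 3 v).M) (κG κ : ℂ)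
    (hOG : ∀ (γH : ((cmDatum L 2 (Matrix.of fun i j : Fin 2 => if i.val + j.val + 1 = 2 then (1 : L) else 0)).Local v × (cmDatum L 1 (Matrix.of fun i j : Fin 1 => if i.val + j.val + 1 = 1 then (1 : L) else 0)).Local v))
      (d' : Fin 2 → (LocalRing L v)ˣ), glDiagonal 2 (LocalRing L v) d' = ((γH.1).val : GL (Fin 2) (LocalRing L v)) → IsLocalGRegular L v γH →
      Valued.v (((d' 1 : (LocalRing L v)ˣ) : LocalRing L v) w) < Valued.v (((d' 0 : (LocalRing L v)ˣ) : LocalRing L v) w) →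
      galAdicCompletionMap (L := L) (IsCMField.complexConj L) hw (((d' 0 : (LocalRing L v)ˣ) : LocalRing L v) w) * ((d' 1 : (LocalRing L v)ˣ) : LocalRing L v) w = 1 →
      ∀ (t : ↥(cmBorelTriple L 3 v).M), (t : ↥(unitaryGroupOfForm (conjLocal L (IsCMField.complexConj L) v) (cmLocalForm L 3 v))) = endoEmbLocal L v γH →
      ∀ (hd : glDiagonal 3 (UnitaryGroup.LocalRing L v) ![d' 0, (isUnit_finGammaTwo L v γH).unit, d' 1] =
          ((t : ↥(unitaryGroupOfForm (conjLocal L (IsCMField.complexConj L) v) (cmLocalForm L 3 v))) : GL (Fin 3) (UnitaryGroup.LocalRing L v)))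
        (ha : IsUnit ((((![d' 0, (isUnit_finGammaTwo L v γH).unit, d' 1] 0)⁻¹ * ![d' 0, (isUnit_finGammaTwo L v γH).unit, d' 1] 1 : (UnitaryGroup.LocalRing L v)ˣ) : (UnitaryGroup.LocalRing L v)) - 1))
        (hb' : IsUnit ((((![d' 0, (isUnit_finGammaTwo L v γH).unit, d' 1] 0)⁻¹ * ![d' 0, (isUnit_finGammaTwo L v γH).unit, d' 1] 2 : (UnitaryGroup.LocalRing L v)ˣ) : (UnitaryGroup.LocalRing L v)) - 1)),
      haveI := locallyCompactSpace_cmBorelU L 3 v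
      classOrbitalIntegral mG f
          (ConjClasses.mk (cmDatumLocalCongr L v (1 : GL (Fin 3) (UnitaryGroup.LocalRing L v)) isUnit_one (F0P3cStCharTSDeltaAtLevi.formCongr_one_qsForm L v)
            (t : ↥(unitaryGroupOfForm (conjLocal L (IsCMField.complexConj L) v) (cmLocalForm L 3 v))))) =
        (((letI : MeasurableSpace (UnitaryGroup.LocalRing L v) := borel _; haveI : BorelSpace (UnitaryGroup.LocalRing L v) := ⟨rfl⟩
            haveI : SecondCountableTopology (UnitaryGroup.LocalRing L v) := secondCountableTopology_localRing (E := L) v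
            ((distribHaarChar (UnitaryGroup.LocalRing L v) ha.unit)⁻¹ *
              (HeisRing.skewModulus (conjLocal L (IsCMField.complexConj L) v) (continuous_conjLocal L (IsCMField.complexConj L) v) hb'.unit
                (HeisRing.map_unit_torusCentralScalar_sub_one (conjLocal L (IsCMField.complexConj L) v) (cmLocalForm_eq_over L 3 v) t hd hb'))⁻¹ :
                  ℝ≥0)) : ℝ) : ℂ) *
          ((rootDeltaChar (cmBorelTriple L 3 v).P
              ⟨(t : ↥(unitaryGroupOfForm (conjLocal L (IsCMField.complexConj L) v) (cmLocalForm L 3 v))), (cmBorelTriple L 3 v).M_le t.2⟩ : ℂˣ) : ℂ)⁻¹ *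
          (κG * (B₁.indicator (fun _ => (1 : ℂ)) t + κ * B₂.indicator (fun _ => (1 : ℂ)) t)))
    -- (OH) the per-summand `H`-side closed forms with their step functions
    (C C' : ι → Set (↥(cmBorelTriple L 2 v).M × (cmDatum L 1 (Matrix.of fun i j : Fin 1 => if i.val + j.val + 1 = 1 then (1 : L) else 0)).Local v)) (κH κ' : ι → ℂ)
    (hOHj : ∀ j ∈ s, ∀ (γH : ((cmDatum L 2 (Matrix.of fun i j : Fin 2 => if i.val + j.val + 1 = 2 then (1 : L) else 0)).Local v × (cmDatum L 1 (Matrix.of fun i j : Fin 1 => if i.val + j.val + 1 = 1 then (1 : L) else 0)).Local v))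
      (d' : Fin 2 → (LocalRing L v)ˣ), glDiagonal 2 (LocalRing L v) d' = ((γH.1).val : GL (Fin 2) (LocalRing L v)) → IsLocalGRegular L v γH →
      Valued.v (((d' 1 : (LocalRing L v)ˣ) : LocalRing L v) w) < Valued.v (((d' 0 : (LocalRing L v)ˣ) : LocalRing L v) w) →
      galAdicCompletionMap (L := L) (IsCMField.complexConj L) hw (((d' 0 : (LocalRing L v)ˣ) : LocalRing L v) w) * ((d' 1 : (LocalRing L v)ˣ) : LocalRing L v) w = 1 →
      ∀ (tH : ↥(cmBorelTriple L 2 v).M), (tH : ↥(unitaryGroupOfForm (conjLocal L (IsCMField.complexConj L) v) (cmLocalForm L 2 v))) = γH.1 →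
      ∀ (hdH : glDiagonal 2 (LocalRing L v) d' = ((tH : ↥(unitaryGroupOfForm (conjLocal L (IsCMField.complexConj L) v) (cmLocalForm L 2 v))) : GL (Fin 2) (LocalRing L v)))
        (hb : IsUnit ((((d' 0)⁻¹ * d' 1 : (LocalRing L v)ˣ) : LocalRing L v) - 1)),
      haveI := locallyCompactSpace_cmBorelU L 2 v
      classOrbitalIntegral mH (g j) (ConjClasses.mk (((tH : ↥(unitaryGroupOfForm (conjLocal L (IsCMField.complexConj L) v) (cmLocalForm L 2 v))) :
          ((cmDatum L 2 (Matrix.of fun i j : Fin 2 => if i.val + j.val + 1 = 2 then (1 : L) else 0)).Local v)), γH.2)) =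
        ((rootDeltaChar (cmBorelTriple L 2 v).P ⟨(tH : ↥(unitaryGroupOfForm (conjLocal L (IsCMField.complexConj L) v) (cmLocalForm L 2 v))), (cmBorelTriple L 2 v).M_le tH.2⟩ : ℂˣ) : ℂ)⁻¹ *
          (((letI : MeasurableSpace (LocalRing L v) := borel _; haveI : BorelSpace (LocalRing L v) := ⟨rfl⟩
            haveI : SecondCountableTopology (LocalRing L v) := secondCountableTopology_localRing (E := L) v
            ((HeisRing.skewModulus (conjLocal L (IsCMField.complexConj L) v) (continuous_conjLocal L (IsCMField.complexConj L) v) hb.unit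
              (LineRing.map_unit_torusScalar_sub_one_two (conjLocal L (IsCMField.complexConj L) v) (cmLocalForm_eq_over L 2 v)
                (⟨(tH : ↥(unitaryGroupOfForm (conjLocal L (IsCMField.complexConj L) v) (cmLocalForm L 2 v))), tH.2⟩ :
                  ↥(torusU (conjLocal L (IsCMField.complexConj L) v) (cmLocalForm L 2 v))) hdH hb))⁻¹ : ℝ≥0)) : ℝ) : ℂ) *
          (κH j * ((C j).indicator (fun _ => (1 : ℂ)) (tH, γH.2) + κ' j * (C' j).indicator (fun _ => (1 : ℂ)) (tH, γH.2))))
    -- (CL) the oriented coset checklist of ★ `hc_of_cosetSum`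
    (τ : ι → ℂ) (hC : (s : Set ι).PairwiseDisjoint C)
    (horient : ∀ (γH : ((cmDatum L 2 (Matrix.of fun i j : Fin 2 => if i.val + j.val + 1 = 2 then (1 : L) else 0)).Local v × (cmDatum L 1 (Matrix.of fun i j : Fin 1 => if i.val + j.val + 1 = 1 then (1 : L) else 0)).Local v))
      (d' : Fin 2 → (LocalRing L v)ˣ), glDiagonal 2 (LocalRing L v) d' = ((γH.1).val : GL (Fin 2) (LocalRing L v)) → IsLocalGRegular L v γH →
      Valued.v (((d' 1 : (LocalRing L v)ˣ) : LocalRing L v) w) < Valued.v (((d' 0 : (LocalRing L v)ˣ) : LocalRing L v) w) →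
      galAdicCompletionMap (L := L) (IsCMField.complexConj L) hw (((d' 0 : (LocalRing L v)ˣ) : LocalRing L v) w) * ((d' 1 : (LocalRing L v)ˣ) : LocalRing L v) w = 1 →
      ∀ (t : ↥(cmBorelTriple L 3 v).M), (t : ↥(unitaryGroupOfForm (conjLocal L (IsCMField.complexConj L) v) (cmLocalForm L 3 v))) = endoEmbLocal L v γH →
      t ∉ B₁)
    (hflip : ∀ (γH : ((cmDatum L 2 (Matrix.of fun i j : Fin 2 => if i.val + j.val + 1 = 2 then (1 : L) else 0)).Local v × (cmDatum L 1 (Matrix.of fun i j : Fin 1 => if i.val + j.val + 1 = 1 then (1 : L) else 0)).Local v))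
      (d' : Fin 2 → (LocalRing L v)ˣ), glDiagonal 2 (LocalRing L v) d' = ((γH.1).val : GL (Fin 2) (LocalRing L v)) → IsLocalGRegular L v γH →
      Valued.v (((d' 1 : (LocalRing L v)ˣ) : LocalRing L v) w) < Valued.v (((d' 0 : (LocalRing L v)ˣ) : LocalRing L v) w) →
      galAdicCompletionMap (L := L) (IsCMField.complexConj L) hw (((d' 0 : (LocalRing L v)ˣ) : LocalRing L v) w) * ((d' 1 : (LocalRing L v)ˣ) : LocalRing L v) w = 1 →
      ∀ (tH : ↥(cmBorelTriple L 2 v).M), (tH : ↥(unitaryGroupOfForm (conjLocal L (IsCMField.complexConj L) v) (cmLocalForm L 2 v))) = γH.1 →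
      ∀ j ∈ s, (tH, γH.2) ∉ C' j)
    (hcov : ∀ (γH : ((cmDatum L 2 (Matrix.of fun i j : Fin 2 => if i.val + j.val + 1 = 2 then (1 : L) else 0)).Local v × (cmDatum L 1 (Matrix.of fun i j : Fin 1 => if i.val + j.val + 1 = 1 then (1 : L) else 0)).Local v))
      (d' : Fin 2 → (LocalRing L v)ˣ), glDiagonal 2 (LocalRing L v) d' = ((γH.1).val : GL (Fin 2) (LocalRing L v)) → IsLocalGRegular L v γH →
      Valued.v (((d' 1 : (LocalRing L v)ˣ) : LocalRing L v) w) < Valued.v (((d' 0 : (LocalRing L v)ˣ) : LocalRing L v) w) →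
      galAdicCompletionMap (L := L) (IsCMField.complexConj L) hw (((d' 0 : (LocalRing L v)ˣ) : LocalRing L v) w) * ((d' 1 : (LocalRing L v)ˣ) : LocalRing L v) w = 1 →
      ∀ (tH : ↥(cmBorelTriple L 2 v).M), (tH : ↥(unitaryGroupOfForm (conjLocal L (IsCMField.complexConj L) v) (cmLocalForm L 2 v))) = γH.1 →
      ∀ (t : ↥(cmBorelTriple L 3 v).M), (t : ↥(unitaryGroupOfForm (conjLocal L (IsCMField.complexConj L) v) (cmLocalForm L 3 v))) = endoEmbLocal L v γH →
      t ∈ B₂ → ∃ j ∈ s, (tH, γH.2) ∈ C j)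
    (hsub : ∀ (γH : ((cmDatum L 2 (Matrix.of fun i j : Fin 2 => if i.val + j.val + 1 = 2 then (1 : L) else 0)).Local v × (cmDatum L 1 (Matrix.of fun i j : Fin 1 => if i.val + j.val + 1 = 1 then (1 : L) else 0)).Local v))
      (d' : Fin 2 → (LocalRing L v)ˣ), glDiagonal 2 (LocalRing L v) d' = ((γH.1).val : GL (Fin 2) (LocalRing L v)) → IsLocalGRegular L v γH →
      Valued.v (((d' 1 : (LocalRing L v)ˣ) : LocalRing L v) w) < Valued.v (((d' 0 : (LocalRing L v)ˣ) : LocalRing L v) w) →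
      galAdicCompletionMap (L := L) (IsCMField.complexConj L) hw (((d' 0 : (LocalRing L v)ˣ) : LocalRing L v) w) * ((d' 1 : (LocalRing L v)ˣ) : LocalRing L v) w = 1 →
      ∀ (tH : ↥(cmBorelTriple L 2 v).M), (tH : ↥(unitaryGroupOfForm (conjLocal L (IsCMField.complexConj L) v) (cmLocalForm L 2 v))) = γH.1 →
      ∀ (t : ↥(cmBorelTriple L 3 v).M), (t : ↥(unitaryGroupOfForm (conjLocal L (IsCMField.complexConj L) v) (cmLocalForm L 3 v))) = endoEmbLocal L v γH →
      ∀ j ∈ s, (tH, γH.2) ∈ C j → t ∈ B₂)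
    (hτ : ∀ (γH : ((cmDatum L 2 (Matrix.of fun i j : Fin 2 => if i.val + j.val + 1 = 2 then (1 : L) else 0)).Local v × (cmDatum L 1 (Matrix.of fun i j : Fin 1 => if i.val + j.val + 1 = 1 then (1 : L) else 0)).Local v))
      (d' : Fin 2 → (LocalRing L v)ˣ), glDiagonal 2 (LocalRing L v) d' = ((γH.1).val : GL (Fin 2) (LocalRing L v)) → IsLocalGRegular L v γH →
      Valued.v (((d' 1 : (LocalRing L v)ˣ) : LocalRing L v) w) < Valued.v (((d' 0 : (LocalRing L v)ˣ) : LocalRing L v) w) →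
      galAdicCompletionMap (L := L) (IsCMField.complexConj L) hw (((d' 0 : (LocalRing L v)ˣ) : LocalRing L v) w) * ((d' 1 : (LocalRing L v)ˣ) : LocalRing L v) w = 1 →
      ∀ (tH : ↥(cmBorelTriple L 2 v).M), (tH : ↥(unitaryGroupOfForm (conjLocal L (IsCMField.complexConj L) v) (cmLocalForm L 2 v))) = γH.1 →
      ∀ j ∈ s, (tH, γH.2) ∈ C j → finTau L v γH μ = τ j)
    (hval : ∀ j ∈ s, cj j * κH j = τ j * (κG * κ)) :
    IsLocalDeltaTransfer L (qsForm L) v (finExplicitCollection L (qsForm L) μ hl hr v) mH mG (∑ j ∈ s, cj j • g j) f := by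
  refine F0P3cStCharTSOffStratumSum.isLocalDeltaTransfer_of_levi' L v w hw Kn hKr hK hz hβ ha hα0 hα1 hm
    (finExplicitCollection L (qsForm L) μ hl hr v) mH mG (∑ j ∈ s, cj j • g j) hfHon f hf ?_
  exact F0P3cStCharTSHleviOfClosedForms.hlevi_of_closed_forms L v w hw μ hl hr mH mG (∑ j ∈ s, cj j • g j) f
    (fun t : ↥(cmBorelTriple L 3 v).M => κG * (B₁.indicator (fun _ => (1 : ℂ)) t + κ * B₂.indicator (fun _ => (1 : ℂ)) t))
    (fun x : ↥(cmBorelTriple L 2 v).M × (cmDatum L 1 (Matrix.of fun i j : Fin 1 => if i.val + j.val + 1 = 1 then (1 : L) else 0)).Local v =>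
      ∑ j ∈ s, cj j * (κH j * ((C j).indicator (fun _ => (1 : ℂ)) x + κ' j * (C' j).indicator (fun _ => (1 : ℂ)) x)))
    hOG
    (F0P3cStCharTSHleviSummands.hOH_of_summands L v w hw hmH s cj g hg
      (fun j x => κH j * ((C j).indicator (fun _ => (1 : ℂ)) x + κ' j * (C' j).indicator (fun _ => (1 : ℂ)) x)) hOHj)
    (F0P3cStCharTSHleviCosets.hc_of_cosetSum L v w hw μ B₁ B₂ κG κ s C C' cj κH κ' τ hC horient hflip hcov hsub hτ hval)

end Summit.HodgeConjecture.HodgeConjecture.Cruxes.H413.F0P3cStCharTSTransferChecklist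

end
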